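import Literature.ModelTheory.FiniteModelTheory.WeisfeilerLemanProofs
import HarnessLib

/-!
# The `k`-dimensional Weisfeiler–Leman refinement of vertex-coloured graphs, and an explicit
# stable round

Topic `Literature/ModelTheory/FiniteModelTheory`; companion of `WeisfeilerLeman.lean` (which DEFINES
`k`-WL for plain simple graphs exactly as printed in Dell–Grohe–Rattan 2018, §8) and of
`WeisfeilerLemanProofs.lean`. Cai–Fürer–Immerman (1992, §5) run the SAME refinement on graphs that
come with a colouring of the vertices ("Let `W⁰` be the colouring of `k`-tuples by isomorphism type
of the induced COLOURED subgraph"): the only change is that the atomic type of a tuple records, in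
addition to the `{0,1,2}`-matrix `atp`, the colours of its entries. This file writes that variant
down, with colours in an arbitrary type `κ`:

* `atpC G c v̄ = (atp G v̄, c ∘ v̄)` — the atomic type of a tuple of the coloured graph `(G, c)`;
* `WLColourC κ k i`, `wlColourC G c i v̄` — the canonical round-`i` colours (nested multisets, the
  recurrence of `wlColour` with `atpC` in place of `atp`), `wlColoursC` the multiset over all
  `k`-tuples, and `WLEquivC k G c H d` — `k`-WL does not distinguish `(G, c)` from `(H, d)`
  (agreement at every round);
* PROVED: invariance under colour-preserving isomorphisms (`wlColourC_comp_iso`,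
  `WLEquivC.of_iso`), nesting of the rounds (`wlColourC_eq_of_le`), and an EXPLICIT STABLE ROUND:
  for cross pairs `(v̄, w̄) ∈ V^k × W^k` the relations `E_i = {C_i(v̄) = C_i(w̄)}` decrease with `i`
  and `E_{i+1} = E_i` forces `E_{i+2} = E_{i+1}` (one refinement round only reads the previous
  one), so they are constant from some `i₀ ≤ |V^k|·|W^k|` on; hence agreement at ONE round
  `T ≥ |V^k|·|W^k|` already gives agreement at every round (`forall_wlColourC_eq_of_eq_at`) and
  `WLEquivC ↔` equality of the colour multisets at round `T` (`wlEquivC_iff_wlColoursC_eq`). This is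
  the finite form of the stable colouring `C_∞` (CFI 1992, §5: "the refinement stabilises after at
  most `n^k` rounds"), stated for two graphs at once, which is what a circuit comparing an input
  with a fixed target needs (`Literature/Computability/Complexity/SymmetricWeisfeilerLeman*.lean`).

Not here: the correspondence with counting logics / pebble games for coloured graphs (the proof of
`WeisfeilerLemanProofs.lean` goes through verbatim but is not needed so far).

## References

* [CaiFurerImmerman1992] J.-Y. Cai, M. Fürer, N. Immerman, *An optimal lower bound on the number of
  variables for graph identification*, Combinatorica 12 (1992), §5 (k-dim W-L on coloured graphs;
  stabilisation).
* [DellGroheRattan2018] H. Dell, M. Grohe, G. Rattan, *Lovász meets Weisfeiler and Leman*, ICALP 2018,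
  §8 (atomic types, the recurrence `C_{i+1}`).
-/

namespace Literature.ModelTheory.FiniteModelTheory

universe u v w

variable {V : Type u} {W : Type v} {κ : Type w}

/-! ### Atomic types of coloured tuples -/

/-- The ATOMIC TYPE of a `k`-tuple `v̄` of the vertex-coloured graph `(G, c)`: the matrix `atp G v̄`
(equalities and adjacencies among the entries) together with the colours `(c vⱼ)ⱼ` — the
isomorphism type of the induced coloured subgraph, labelled by positions.
[cite: CaiFurerImmerman1992, §5 (W⁰: isomorphism type of the tuple)] -/
def atpC {k : ℕ} (G : SimpleGraph V) [DecidableEq V] [DecidableRel G.Adj] (c : V → κ)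
    (v : Fin k → V) : (Fin k → Fin k → Fin 3) × (Fin k → κ) :=
  (atp G v, c ∘ v)

/-- Coloured atomic types are invariant under colour-preserving isomorphisms. [folklore] -/
theorem atpC_comp_iso {k : ℕ} {G : SimpleGraph V} {H : SimpleGraph W} [DecidableEq V]
    [DecidableEq W] [DecidableRel G.Adj] [DecidableRel H.Adj] {c : V → κ} {d : W → κ}
    (e : G ≃g H) (hc : ∀ x, d (e x) = c x) (v : Fin k → V) :
    atpC H d (e ∘ v) = atpC G c v := by
  refine Prod.ext (atp_comp_iso e v) (funext fun j => ?_)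
  exact hc (v j)

/-! ### The refinement -/

/-- The CANONICAL COLOURS of round `i` of `k`-WL on vertex-coloured graphs with colours in `κ`:
coloured atomic types at round `0`; at round `i + 1` the old colour together with the multiset,
over the new vertex `w`, of (coloured atomic type of the extended tuple, old colours of the `k`
substituted tuples). [cite: CaiFurerImmerman1992, §5 (the refinement step on coloured graphs)] -/
def WLColourC (κ : Type w) (k : ℕ) : ℕ → Type w
  | 0 => (Fin k → Fin k → Fin 3) × (Fin k → κ)
  | i + 1 => WLColourC κ k i ×
      Multiset (((Fin (k + 1) → Fin (k + 1) → Fin 3) × (Fin (k + 1) → κ)) × (Fin k → WLColourC κ k i))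

/-- Colours have decidable equality when the vertex colours do (nested finite multisets).
[folklore] -/
instance instDecidableEqWLColourC [DecidableEq κ] (k : ℕ) : (i : ℕ) → DecidableEq (WLColourC κ k i)
  | 0 => inferInstanceAs (DecidableEq ((Fin k → Fin k → Fin 3) × (Fin k → κ)))
  | i + 1 =>
    letI : DecidableEq (WLColourC κ k i) := instDecidableEqWLColourC k i
    -- composed by hand: the nested search exceeds the default instance-search size
    letI : DecidableEq (Fin (k + 1) → κ) := inferInstance
    letI : DecidableEq (Fin k → WLColourC κ k i) := inferInstance
    letI : DecidableEq ((Fin (k + 1) → Fin (k + 1) → Fin 3) × (Fin (k + 1) → κ)) := inferInstance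
    letI : DecidableEq (((Fin (k + 1) → Fin (k + 1) → Fin 3) × (Fin (k + 1) → κ)) ×
        (Fin k → WLColourC κ k i)) := inferInstance
    letI : DecidableEq (Multiset (((Fin (k + 1) → Fin (k + 1) → Fin 3) × (Fin (k + 1) → κ)) ×
        (Fin k → WLColourC κ k i))) := inferInstance
    inferInstanceAs (DecidableEq (WLColourC κ k i ×
      Multiset (((Fin (k + 1) → Fin (k + 1) → Fin 3) × (Fin (k + 1) → κ)) ×
        (Fin k → WLColourC κ k i))))

/-- **`k`-WL colours of a vertex-coloured graph**: `C₀(v̄) = atpC(v̄)` and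
`C_{i+1}(v̄) = (C_i(v̄), {{ (atpC(v̄, w), (C_i(v̄[j ↦ w]))_{j}) | w ∈ V }})`.
[cite: CaiFurerImmerman1992, §5 (k-dim W-L refinement); DellGroheRattan2018, §8] -/
def wlColourC {k : ℕ} (G : SimpleGraph V) [Fintype V] [DecidableEq V] [DecidableRel G.Adj]
    (c : V → κ) : (i : ℕ) → (Fin k → V) → WLColourC κ k i
  | 0 => fun v => atpC G c v
  | i + 1 => fun v =>
      (wlColourC G c i v, (Finset.univ : Finset V).val.map fun w =>
        (atpC G c (Fin.snoc v w : Fin (k + 1) → V), fun j => wlColourC G c i (Function.update v j w)))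

/-- The multiset of round-`i` colours of all `k`-tuples of the coloured graph `(G, c)`. [folklore] -/
def wlColoursC (k : ℕ) (G : SimpleGraph V) [Fintype V] [DecidableEq V] [DecidableRel G.Adj]
    (c : V → κ) (i : ℕ) : Multiset (WLColourC κ k i) :=
  (Finset.univ : Finset (Fin k → V)).val.map (wlColourC G c i)

/-- **`k`-WL equivalence of vertex-coloured graphs**: at every round the multisets of colours of all
`k`-tuples of `(G, c)` and `(H, d)` coincide. [cite: CaiFurerImmerman1992, §5 (W-L does not distinguish)] -/
def WLEquivC (k : ℕ) (G : SimpleGraph V) (c : V → κ) (H : SimpleGraph W) (d : W → κ) [Fintype V]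
    [DecidableEq V] [DecidableRel G.Adj] [Fintype W] [DecidableEq W] [DecidableRel H.Adj] : Prop :=
  ∀ i : ℕ, wlColoursC k G c i = wlColoursC k H d i

/-! ### Proved API -/

section API

variable {k : ℕ} {G : SimpleGraph V} {H : SimpleGraph W} [Fintype V] [DecidableEq V]
  [DecidableRel G.Adj] [Fintype W] [DecidableEq W] [DecidableRel H.Adj] {c : V → κ} {d : W → κ}

/-- Round `0` is the coloured atomic type. [folklore] -/
theorem wlColourC_zero (v : Fin k → V) : wlColourC G c 0 v = atpC G c v := rfl

/-- The refinement round, unfolded. [folklore] -/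
theorem wlColourC_succ (i : ℕ) (v : Fin k → V) :
    wlColourC G c (i + 1) v = (wlColourC G c i v, (Finset.univ : Finset V).val.map fun w =>
      (atpC G c (Fin.snoc v w : Fin (k + 1) → V), fun j => wlColourC G c i (Function.update v j w))) :=
  rfl

/-- Colours are invariant under colour-preserving isomorphisms: `C_i(H; e ∘ v̄) = C_i(G; v̄)`.
[folklore] -/
theorem wlColourC_comp_iso (e : G ≃g H) (hc : ∀ x, d (e x) = c x) : ∀ (i : ℕ) (v : Fin k → V),
    wlColourC H d i (e ∘ v) = wlColourC G c i v
  | 0, v => atpC_comp_iso e hc v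
  | i + 1, v => by
    simp only [wlColourC]
    refine Prod.ext (wlColourC_comp_iso e hc i v) ?_
    have huniv : (Finset.univ : Finset W).val = (Finset.univ : Finset V).val.map e := by
      rw [← Finset.map_univ_equiv e.toEquiv, Finset.map_val]
      rfl
    rw [huniv, Multiset.map_map]
    refine Multiset.map_congr rfl fun w _ => ?_
    simp only [Function.comp_apply]
    refine Prod.ext ?_ (funext fun j => ?_)
    · show atpC H d (Fin.snoc (e ∘ v) (e w) : Fin (k + 1) → W) = atpC G c (Fin.snoc v w)
      have : (Fin.snoc (e ∘ v) (e w) : Fin (k + 1) → W) = e ∘ Fin.snoc v w := by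
        funext l
        refine Fin.lastCases ?_ (fun l => ?_) l
        · simp
        · simp [Fin.snoc_castSucc]
      rw [this, atpC_comp_iso e hc]
    · show wlColourC H d i (Function.update (e ∘ v) j (e w)) = wlColourC G c i (Function.update v j w)
      have : Function.update (e ∘ v) j (e w) = e ∘ Function.update v j w := by
        rw [Function.comp_update]
      rw [this, wlColourC_comp_iso e hc i]

/-- Colour-isomorphic coloured graphs are `k`-WL equivalent. [folklore] -/
theorem WLEquivC.of_iso (e : G ≃g H) (hc : ∀ x, d (e x) = c x) : WLEquivC k G c H d := by
  intro i
  let Φ : (Fin k → V) ≃ (Fin k → W) := (Equiv.refl (Fin k)).arrowCongr e.toEquiv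
  have huniv : (Finset.univ : Finset (Fin k → W)).val =
      (Finset.univ : Finset (Fin k → V)).val.map Φ := by
    rw [← Finset.map_univ_equiv Φ, Finset.map_val]
    rfl
  simp only [wlColoursC]
  rw [huniv, Multiset.map_map]
  refine Multiset.map_congr rfl fun v _ => ?_
  have hΦ : (Φ v : Fin k → W) = e ∘ v := by
    funext j
    simp [Φ, Equiv.arrowCongr_apply]
  simp only [Function.comp_apply]
  rw [hΦ, wlColourC_comp_iso e hc]

/-- Later rounds refine earlier ones, across the two coloured graphs. [folklore] -/
theorem wlColourC_eq_of_le {v : Fin k → V} {w : Fin k → W} {i : ℕ} :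
    ∀ {j : ℕ}, i ≤ j → wlColourC G c j v = wlColourC H d j w → wlColourC G c i v = wlColourC H d i w := by
  intro j hij
  induction hij with
  | refl => exact id
  | step _ ih => exact fun h => ih (congrArg Prod.fst h)

/-! ### An explicit stable round -/

/-- ONE-STEP PROPAGATION OF STABILITY. If round `i + 1` separates no cross pair that round `i` does
not (`C_{i+1}(v̄) = C_{i+1}(w̄) ↔ C_i(v̄) = C_i(w̄)` for all `v̄, w̄`), then neither does round
`i + 2`: the refinement step reads only the previous round, so a bijection matching the round-`i`
data of the substituted tuples matches their round-`(i+1)` data as well.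
[cite: CaiFurerImmerman1992, §5 (stabilisation of the refinement)] -/
theorem wlColourC_succ_succ_iff_of_succ_iff {i : ℕ}
    (hst : ∀ (v : Fin k → V) (w : Fin k → W),
      wlColourC G c (i + 1) v = wlColourC H d (i + 1) w ↔ wlColourC G c i v = wlColourC H d i w)
    (v : Fin k → V) (w : Fin k → W) :
    wlColourC G c (i + 2) v = wlColourC H d (i + 2) w ↔
      wlColourC G c (i + 1) v = wlColourC H d (i + 1) w := by
  refine ⟨fun h => congrArg Prod.fst h, fun h => ?_⟩
  have hmult : ((Finset.univ : Finset V).val.map fun x =>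
      (atpC G c (Fin.snoc v x : Fin (k + 1) → V), fun j => wlColourC G c i (Function.update v j x))) =
      (Finset.univ : Finset W).val.map fun y =>
      (atpC H d (Fin.snoc w y : Fin (k + 1) → W), fun j => wlColourC H d i (Function.update w j y)) :=
    congrArg Prod.snd h
  obtain ⟨f, hf⟩ := exists_equiv_of_map_univ_eq _ _ hmult
  show (wlColourC G c (i + 1) v, (Finset.univ : Finset V).val.map fun x =>
      (atpC G c (Fin.snoc v x : Fin (k + 1) → V), fun j => wlColourC G c (i + 1) (Function.update v j x))) =
    (wlColourC H d (i + 1) w, (Finset.univ : Finset W).val.map fun y =>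
      (atpC H d (Fin.snoc w y : Fin (k + 1) → W), fun j => wlColourC H d (i + 1) (Function.update w j y)))
  refine Prod.ext h ?_
  have huniv : (Finset.univ : Finset W).val = (Finset.univ : Finset V).val.map f := by
    rw [← Finset.map_univ_equiv f, Finset.map_val]
    rfl
  show ((Finset.univ : Finset V).val.map fun x =>
      (atpC G c (Fin.snoc v x : Fin (k + 1) → V), fun j => wlColourC G c (i + 1) (Function.update v j x))) =
    (Finset.univ : Finset W).val.map fun y =>
      (atpC H d (Fin.snoc w y : Fin (k + 1) → W), fun j => wlColourC H d (i + 1) (Function.update w j y))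
  rw [huniv, Multiset.map_map]
  refine Multiset.map_congr rfl fun x _ => ?_
  obtain ⟨hx₁, hx₂⟩ := Prod.mk.inj (hf x)
  simp only [Function.comp_apply]
  refine Prod.ext hx₁.symm (funext fun j => ?_)
  exact (hst _ _).2 (congrFun hx₂ j).symm

variable [DecidableEq κ]

/-- **An explicit stable round.** For two coloured graphs on finite vertex types `V`, `W`: if the
round-`T` colours of the cross pair `(v̄, w̄)` agree for ONE `T ≥ |V^k| · |W^k|`, then they agree at
every round. (The agreement relations `E_i ⊆ V^k × W^k` decrease with `i`, each strict decrease
costs an element, and by `wlColourC_succ_succ_iff_of_succ_iff` the first non-strict step is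
followed only by non-strict steps.) [cite: CaiFurerImmerman1992, §5 (the stable refinement is reached after at most n^k rounds)] -/
theorem forall_wlColourC_eq_of_eq_at {T : ℕ}
    (hT : Fintype.card (Fin k → V) * Fintype.card (Fin k → W) ≤ T) {v : Fin k → V} {w : Fin k → W}
    (h : wlColourC G c T v = wlColourC H d T w) (i : ℕ) : wlColourC G c i v = wlColourC H d i w := by
  classical
  -- the agreement relations
  obtain ⟨E, hE⟩ : ∃ E : ℕ → Finset ((Fin k → V) × (Fin k → W)),
      ∀ i q, q ∈ E i ↔ wlColourC G c i q.1 = wlColourC H d i q.2 :=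
    ⟨fun i => Finset.univ.filter fun q => wlColourC G c i q.1 = wlColourC H d i q.2, fun i q => by simp⟩
  have hanti : ∀ {i j : ℕ}, i ≤ j → E j ⊆ E i := fun hij q hq =>
    (hE _ _).2 (wlColourC_eq_of_le hij ((hE _ _).1 hq))
  have hstep : ∀ i, E (i + 1) = E i → E (i + 2) = E (i + 1) := by
    intro i hi
    ext q
    rw [hE, hE]
    refine wlColourC_succ_succ_iff_of_succ_iff (fun v' w' => ?_) q.1 q.2
    have := congrArg (fun s => (v', w') ∈ s) hi
    simp only [eq_iff_iff] at this
    rwa [hE, hE] at this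
  set N := Fintype.card (Fin k → V) * Fintype.card (Fin k → W) with hN
  have hcard0 : (E 0).card ≤ N := by
    rw [hN, ← Fintype.card_prod]
    exact Finset.card_le_univ _
  -- pigeonhole: some step `i₀ ≤ N` is not strict
  obtain ⟨i₀, hi₀N, hi₀⟩ : ∃ i₀, i₀ ≤ N ∧ E (i₀ + 1) = E i₀ := by
    by_contra hall
    simp only [not_exists, not_and] at hall
    have hlt : ∀ i, i ≤ N → (E (i + 1)).card < (E i).card := fun i hi =>
      Finset.card_lt_card ((Finset.ssubset_iff_subset_ne).2 ⟨hanti (Nat.le_succ i), hall i hi⟩)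
    have hle : ∀ i, i ≤ N + 1 → (E i).card + i ≤ (E 0).card := by
      intro i
      induction i with
      | zero => intro _; simp
      | succ i ih =>
        intro hi
        have := ih (by omega)
        have := hlt i (by omega)
        omega
    have := hle (N + 1) le_rfl
    omega
  -- from `i₀` on the relations are constant
  have hconst' : ∀ j, E (i₀ + j + 1) = E (i₀ + j) := by
    intro j
    induction j with
    | zero => simpa using hi₀
    | succ j ih =>
      have := hstep (i₀ + j) ih
      simpa [Nat.add_assoc] using this
  have hconst : ∀ j, E (i₀ + j) = E i₀ := by
    intro j
    induction j with
    | zero => rfl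
    | succ j ih => rw [← ih, ← Nat.add_assoc]; exact hconst' j
  have hmem : (v, w) ∈ E T := (hE _ _).2 h
  rcases le_total i T with hi | hi
  · exact (hE _ _).1 (hanti hi hmem)
  · have h1 : E i = E i₀ := by
      obtain ⟨j, rfl⟩ := Nat.exists_eq_add_of_le (show i₀ ≤ i by omega)
      exact hconst j
    have h2 : E T = E i₀ := by
      obtain ⟨j, rfl⟩ := Nat.exists_eq_add_of_le (show i₀ ≤ T by omega)
      exact hconst j
    rw [← h2] at h1
    rw [← h1] at hmem
    exact (hE _ _).1 hmem

/-- **`k`-WL equivalence is decided at one explicit round**: `(G, c)` and `(H, d)` are `k`-WL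
equivalent iff their colour multisets agree at round `T`, for any `T ≥ |V^k| · |W^k|`.
[cite: CaiFurerImmerman1992, §5 (stable colourings)] -/
theorem wlEquivC_iff_wlColoursC_eq {T : ℕ}
    (hT : Fintype.card (Fin k → V) * Fintype.card (Fin k → W) ≤ T) :
    WLEquivC k G c H d ↔ wlColoursC k G c T = wlColoursC k H d T := by
  refine ⟨fun h => h T, fun h i => ?_⟩
  obtain ⟨Φ, hΦ⟩ := exists_equiv_of_map_univ_eq _ _ h
  have huniv : (Finset.univ : Finset (Fin k → W)).val =
      (Finset.univ : Finset (Fin k → V)).val.map Φ := by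
    rw [← Finset.map_univ_equiv Φ, Finset.map_val]
    rfl
  simp only [wlColoursC]
  rw [huniv, Multiset.map_map]
  refine Multiset.map_congr rfl fun u _ => ?_
  simp only [Function.comp_apply]
  exact forall_wlColourC_eq_of_eq_at hT (hΦ u).symm i

end API

end Literature.ModelTheory.FiniteModelTheory
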